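import Summits.HodgeConjecture.HodgeConjecture.Theorems.Ring2WeilCoverageWeilGramLevel32PrimeThirtyOneSqrtNegOne
import Summits.HodgeConjecture.HodgeConjecture.Theorems.Ring2WeilCoverageWeilGramLevel32PrimeThirtyOneSqrtNegTwo
import Summits.HodgeConjecture.HodgeConjecture.Theorems.Ring2WeilCoverageWeilGramLevel32TypeLaw
import Summits.HodgeConjecture.HodgeConjecture.Theorems.Ring2WeilCoverageRealGeneratorTypes
import Summits.HodgeConjecture.HodgeConjecture.Theorems.Ring2WeilNormObstructionDescent
import HarnessLib

/-!
# Weil-type family coverage — NON-SPLIT `ℤ[ζ₃₂]`-CM EIGHTFOLDS, III: `N_{K⁺/ℚ}(π₃₁) = −31` FROM TWO GRAM DETERMINANTS, the type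
# `(π₃₁)` OCCURS on every CM type of `ℚ(ζ₃₂)` (part 61), every `Φ`-positive divisor of that type on a `(4,4)` type has
# `det a = 31·det a(ξ)` (the law of part 199), and `[31]` is NOT split: **the rows `(4, ℚ(i), 31)`, `(4, ℚ(√−2), 31)` — the
# smallest non-split classes reached by `ℤ[ζ_M]`-CM points at an all-YES level**

research route conditional on HC_CM; not a corollary; Q11.4-sentence-2 already refuted in dim ≥ 3.

Ring 2, WEIL-TYPE FAMILY-COVERAGE CENSUS (`HOME/WEIL-FAMILY-COVERAGE.md` `## b01`, block b01.50 (C); owner ring2-b01), part 202 of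
the `Ring2WeilCoverage*` series; continues parts 200–201 (the Gram data of `π₃₁ξ`) and part 199 (`…Level32TypeLaw`).
At `32` THEOREM L (i) FAILS (part 61: `ℚ(ζ₃₂)⁺` has a unit of norm `−1`, e.g. `−1−θ`) and the norm-sign law degenerates:
EVERY principal-ideal type `(ϖ₀)`, `ϖ₀ ∈ ℤ[ζ₃₂]⁺ ∖ 0`, occurs on EVERY CM type (part 61 `exists_type_span_thirtyTwo`).  The
component rule then reads: a skew `ζ′` of type `(ϖ₀)` is `u·ϖ₀ξ`, `u` a real unit of norm `±1`, so `det a(ζ′, s) =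
±N(ϖ₀)·det a(ξ, s)`, and `Φ`-positivity on a `(4,4)` type fixes the sign: `det a = |N_{K⁺/ℚ}(ϖ₀)|·det a(ξ, s)` — class
`[2|N(ϖ₀)|] = [|N(ϖ₀)|]` (`det a(ξ, s_d) = 2^7 d^4`, and `2 ∈ Nm(ℚ(i)ˣ), Nm(ℚ(√−2)ˣ)`).  The smallest non-trivial class: the
prime `π₃₁ = −1 − 2θ + θ²` over `31 ≡ −1 (mod 32)` (inert in `K/K⁺`), `N(π₃₁) = −31`: rows `(4, ℚ(i), 31)`, `(4, ℚ(√−2), 31)`.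

* §1 the generator `π₃₁ = −1 − 2θ + θ² ∈ 𝓞 K` (`θ = ζ + ζ³¹`): coercion, reality, `ζ³¹ = ζ⁻¹`, non-vanishing, and **`N_{K⁺/ℚ}(β₀) = −31`
  for every `β₀ ∈ K⁺` over `π₃₁`** (part 199 `det_realPart_realMul_xi_sqrtNegOne`: `−3968 = N(β₀)·128`).
* §2–§3 (`d = 1, 2`): **CENSUS FORM** `exists_primeThirtyOne_<s>_det` (for every CM type of `s`-signature `(4,4)` there is a type
  `𝔣₀ = (ϖ₀)`, `𝔬𝔣₀ = (π₃₁)`, carrying a `Φ`-positive divisor — part 61 — and EVERY such divisor has `det a = 31·det a(ξ, s)`, by the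
  law of part 199 with `|N(ϖ₀)| = 31`), **class** `mk0_det_primeThirtyOne_<s>`: `[31·det a(ξ, s)] = [31] ≠ splitDiscriminantClass 4 d`
  (`31` inert in `ℚ(i)` and `ℚ(√−2)`: anisotropy mod `31` by `decide`, `Ring2WeilNormDescent.natCast_not_mem_normUnitsSubgroup`).

HONEST FRAMING as parts 82–201: kernel statements about traces and norms in `ℚ(ζ₃₂)`, Shimura's divisors of type `(K; Φ; 𝔣₀)`
on `ℂ^Φ/Φ(ℤ[ζ₃₂])` and norm classes; nothing about Hodge classes, `W_K`, general members or HC; `HC_CM` is used nowhere.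
No `def`, no named fact, no `sorry`.

References: [cite: vanGeemen1994HodgeAV, Lemma 5.2 (2)–(4), 5.4 and (5.4.1)]; [cite: Shimura1998, §14.3 Prop. 4–5,
pp. 103–104]; [cite: Serre1973, Ch. III §1]; census b01.50 (seat-derived).
-/

noncomputable section

open Polynomial NumberField Module
open scoped nonZeroDivisors

namespace Summit.HodgeConjecture.Ring2WeilCoverage.WeilGramLevel32PrimeThirtyOneTypes

open Literature.AlgebraicGeometry.VanGeemen1994 (weilField weilNormResidueGroup)
open Literature.AlgebraicGeometry.Motives (CMType normUnitsSubgroup)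
open Literature.NumberTheory.ComplexMultiplication
open Summit.HodgeConjecture.Ring2WeilCoverage.WeilGramTools
open Summit.HodgeConjecture.Ring2WeilCoverage.WeilGramCMPoint
open Summit.HodgeConjecture.Ring2WeilCoverage.RealUnitNormHalfSystems (complexConj_eq_inv)
open Summit.HodgeConjecture.Ring2WeilCoverage.CyclotomicPrincipalObstruction (complexConj_xi)
open Summit.HodgeConjecture.Ring2WeilCoverage.CyclotomicDifferent (isOfType_one_xi_top xi_ne_zero)
open Summit.HodgeConjecture.HodgeConjecture.Ring2.WeilCoverage (mk_neg_eq_split_of_odd mk_neg_ne_split_of_odd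
  mk_eq_split_of_even mk_ne_split_of_even mem_normUnitsSubgroup_of_sq_add_mul_sq natCast_not_mem_normUnitsSubgroup_of_ramified)
open Summit.HodgeConjecture.HodgeConjecture.Ring2.Hypotheses (splitDiscriminantClass)
open Summit.HodgeConjecture.Ring2WeilCoverage.WeilGramLevel32
open Summit.HodgeConjecture.Ring2WeilCoverage.WeilGramLevel32TypeLaw
open Summit.HodgeConjecture.Ring2WeilCoverage.WeilGramLevel32PrimeThirtyOneSqrtNegOne
open Summit.HodgeConjecture.Ring2WeilCoverage.WeilGramLevel32PrimeThirtyOneSqrtNegTwo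
open Summit.HodgeConjecture.Ring2WeilNormDescent (natCast_not_mem_normUnitsSubgroup descent_hyps_of_anisotropic anisotropic_of_forall_sq_ne mk_ne_splitDiscriminantClass_of_even)
variable {K : Type} [Field K] [NumberField K] {ζ : K}

/-- the image in `K` of an integer `ϖ₀` of the maximal real subfield (part 55's notation). -/
local notation3 (prettyPrint := false) "𝓇 " x:max => (algebraMap (𝓞 (maximalRealSubfield K)) K x)

/-! ### §1 The generator `π₃₁ = −1 − 2θ + θ²`: coercion, reality, `ζ³¹ = ζ⁻¹`, non-vanishing, `N_{K⁺/ℚ}(π₃₁) = −31` -/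

omit [NumberField K] in
/-- `ζ³¹ = ζ⁻¹` for a primitive 32nd root of unity. [folklore] -/
theorem pow_thirtyOne_eq_inv (hζ : IsPrimitiveRoot ζ 32) : ζ ^ 31 = ζ⁻¹ := by
  rw [← inv_pow_eq_pow hζ (show 1 + 31 = 32 by norm_num), pow_one]

omit [NumberField K] in
/-- The integer `π₃₁ = −1 − 2θ + θ²` of `𝓞 K` (`θ = ζ + ζ³¹`) coerces to the field element. [folklore] -/
theorem coe_primeThirtyOne (hζ : IsPrimitiveRoot ζ 32) :
    (((-1 - 2 * (hζ.toInteger + hζ.toInteger ^ 31) + (hζ.toInteger + hζ.toInteger ^ 31) ^ 2) : 𝓞 K) : K) = (-1 - 2 * (ζ + ζ ^ 31) + (ζ + ζ ^ 31) ^ 2) := by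
  push_cast
  rfl

/-- **`π₃₁` is REAL** (a polynomial in `θ = ζ + ζ⁻¹`). [folklore] -/
theorem complexConj_primeThirtyOne [IsCMField K] (hζ : IsPrimitiveRoot ζ 32) :
    IsCMField.complexConj K (-1 - 2 * (ζ + ζ ^ 31) + (ζ + ζ ^ 31) ^ 2) = (-1 - 2 * (ζ + ζ ^ 31) + (ζ + ζ ^ 31) ^ 2) := by
  rw [pow_thirtyOne_eq_inv hζ]
  have hθ := complexConj_theta hζ
  set θ := ζ + ζ⁻¹ with hθdef
  simp only [map_add, map_sub, map_neg, map_mul, map_pow, map_ofNat, map_one, hθ]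

/-- **`π₃₁ ≠ 0`** — its Gram determinant against `i` is `-3968 ≠ 0` (part 200). [folklore] -/
theorem primeThirtyOne_ne_zero [IsCyclotomicExtension {32} ℚ K] [IsCMField K] (hζ : IsPrimitiveRoot ζ 32) :
    (-1 - 2 * (ζ + ζ ^ 31) + (ζ + ζ ^ 31) ^ 2) ≠ 0 := by
  intro h
  have hD := det_realPart_primeThirtyOne_sqrtNegOne hζ (x := fun i : Fin 8 => (ζ + ζ⁻¹) ^ (i : ℕ)) (fun i => rfl)
    (a := Matrix.of fun i j : Fin 8 => Algebra.trace ℚ K ((-1 - 2 * (ζ + ζ ^ 31) + (ζ + ζ ^ 31) ^ 2) * (ζ ^ 7 * (aeval ζ (derivative (cyclotomic 32 ℚ)))⁻¹) * (ζ + ζ⁻¹) ^ (i : ℕ) *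
      IsCMField.complexConj K ((ζ ^ 8) * (ζ + ζ⁻¹) ^ (j : ℕ)))) (fun i j => rfl)
  have h0 : (Matrix.of fun i j : Fin 8 => Algebra.trace ℚ K ((-1 - 2 * (ζ + ζ ^ 31) + (ζ + ζ ^ 31) ^ 2) * (ζ ^ 7 * (aeval ζ (derivative (cyclotomic 32 ℚ)))⁻¹) * (ζ + ζ⁻¹) ^ (i : ℕ) *
      IsCMField.complexConj K ((ζ ^ 8) * (ζ + ζ⁻¹) ^ (j : ℕ)))) = 0 := by
    ext i j
    simp only [Matrix.of_apply, Matrix.zero_apply, h, zero_mul, map_zero]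
  rw [h0, Matrix.det_zero] at hD
  norm_num at hD

/-- **`N_{K⁺/ℚ}(π₃₁) = −31`** for every `β₀ ∈ K⁺` over `π₃₁`: part 199 `det_realPart_realMul_xi_sqrtNegOne` gives
`det a(β₀ξ, i) = N(β₀)·128`, and part 200 computes `det a(π₃₁ξ, i) = -3968`; so `N = -3968/128 = −31` — the prime over `31`
is INERT in `K/K⁺` and its generator has NEGATIVE norm, as the product formula predicts.
research route conditional on HC_CM; not a corollary; Q11.4-sentence-2 already refuted in dim ≥ 3. [folklore] -/
theorem norm_primeThirtyOne [IsCyclotomicExtension {32} ℚ K] [IsCMField K] (hζ : IsPrimitiveRoot ζ 32)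
    (β₀ : 𝓞 (maximalRealSubfield K)) (hβ : 𝓇 β₀ = (-1 - 2 * (ζ + ζ ^ 31) + (ζ + ζ ^ 31) ^ 2)) :
    Algebra.norm ℚ ((β₀ : maximalRealSubfield K)) = -31 := by
  have hx : ∀ i : Fin 8, (fun i : Fin 8 => (ζ + ζ⁻¹) ^ (i : ℕ)) i = (ζ + ζ⁻¹) ^ (i : ℕ) := fun i => rfl
  have hD1 := det_realPart_primeThirtyOne_sqrtNegOne hζ hx (a := Matrix.of fun i j => Algebra.trace ℚ K
    ((-1 - 2 * (ζ + ζ ^ 31) + (ζ + ζ ^ 31) ^ 2) * (ζ ^ 7 * (aeval ζ (derivative (cyclotomic 32 ℚ)))⁻¹) * (ζ + ζ⁻¹) ^ (i : ℕ) * IsCMField.complexConj K ((ζ ^ 8) * (ζ + ζ⁻¹) ^ (j : ℕ)))) (fun i j => rfl)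
  have hL := det_realPart_realMul_xi_sqrtNegOne hζ β₀ hx (a := Matrix.of fun i j => Algebra.trace ℚ K
    ((-1 - 2 * (ζ + ζ ^ 31) + (ζ + ζ ^ 31) ^ 2) * (ζ ^ 7 * (aeval ζ (derivative (cyclotomic 32 ℚ)))⁻¹) * (ζ + ζ⁻¹) ^ (i : ℕ) * IsCMField.complexConj K ((ζ ^ 8) * (ζ + ζ⁻¹) ^ (j : ℕ)))) (fun i j => by rw [Matrix.of_apply, hβ])
  rw [hD1] at hL
  linarith

/-! ### §2 `K_d = ℚ(i)` (`s = i`): census form for the type `(π₃₁)`, class `[31]` NON-SPLIT (row W8.1.31) -/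

open scoped Classical in
/-- **CENSUS FORM** (`K_d = ℚ(i)` at `32`): for every CM type `Φ` of `i`-signature `(4,4)` there is a type `𝔣₀ ⊆ 𝓞 K⁺` with
`𝔬𝔣₀ = (π₃₁)` (`𝔣₀ = (ϖ₀)`, `ϖ₀ ∈ 𝓞 K⁺` under `π₃₁`) such that `ℂ^Φ/Φ(ℤ[ζ_32])` CARRIES a `Φ`-positive divisor of type `(K; Φ; 𝔣₀)`
(part 61: every type occurs at `32`) and EVERY such divisor has van Geemen Gram determinant `3968 = 31·128` in the real frame `θ^i`
(the law of part 199 with `|N(ϖ₀)| = |−31|`): the type-`(π₃₁)` polarised Weil-type `ℤ[ζ₃₂]`-CM eightfolds for `ℚ(i)` lie on the NON-SPLIT row W8.1.31 `= (4, ℚ(i), 31)`.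
research route conditional on HC_CM; not a corollary; Q11.4-sentence-2 already refuted in dim ≥ 3. [cite: vanGeemen1994HodgeAV, Lemma 5.2 (3)–(4) and (5.4.1)] [cite: Shimura1998, §14.3 Prop. 4–5, pp. 103–104] -/
theorem exists_primeThirtyOne_sqrtNegOne_det [IsCyclotomicExtension {32} ℚ K] [IsCMField K]
    (hζ : IsPrimitiveRoot ζ 32) (Φ : CMType K)
    (hneg : (Finset.univ.filter fun φ : Φ.1 => (φ.1 (ζ ^ 8)).im < 0).card = 4)
    (hposc : (Finset.univ.filter fun φ : Φ.1 => 0 < (φ.1 (ζ ^ 8)).im).card = 4) :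
    ∃ 𝔣₀ : Ideal (𝓞 (maximalRealSubfield K)),
      𝔣₀.map (algebraMap (𝓞 (maximalRealSubfield K)) (𝓞 K)) =
        Ideal.span {(-1 - 2 * (hζ.toInteger + hζ.toInteger ^ 31) + (hζ.toInteger + hζ.toInteger ^ 31) ^ 2)} ∧
      ∃ ζ' : K, IsCMField.complexConj K ζ' = -ζ' ∧ (∀ φ : Φ.1, 0 < (φ.1 ζ').im) ∧
        CMTypeLattice.IsOfType (1 : (FractionalIdeal (𝓞 K)⁰ K)ˣ) ζ' 𝔣₀ ∧
        ∀ (x : Fin 8 → K), (∀ i, x i = (ζ + ζ⁻¹) ^ (i : ℕ)) → ∀ a : Matrix (Fin 8) (Fin 8) ℚ,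
          (∀ i j, a i j = Algebra.trace ℚ K (ζ' * x i * IsCMField.complexConj K ((ζ ^ 8) * x j))) →
          a.det = 3968 := by
  have hP := coe_primeThirtyOne hζ
  have hreal : IsCMField.complexConj K ((((-1 - 2 * (hζ.toInteger + hζ.toInteger ^ 31) + (hζ.toInteger + hζ.toInteger ^ 31) ^ 2) : 𝓞 K)) : K) =
      ((((-1 - 2 * (hζ.toInteger + hζ.toInteger ^ 31) + (hζ.toInteger + hζ.toInteger ^ 31) ^ 2) : 𝓞 K)) : K) := by
    rw [hP]; exact complexConj_primeThirtyOne hζ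
  obtain ⟨ϖ₀, hϖ⟩ := (IsCMField.RingOfIntegers.complexConj_eq_self_iff (K := K) _).mp hreal
  have h𝔣₀ : (Ideal.span {ϖ₀}).map (algebraMap (𝓞 (maximalRealSubfield K)) (𝓞 K)) =
      Ideal.span {(-1 - 2 * (hζ.toInteger + hζ.toInteger ^ 31) + (hζ.toInteger + hζ.toInteger ^ 31) ^ 2)} := by
    rw [Ideal.map_span, Set.image_singleton]
    congr 2
    apply RingOfIntegers.ext
    rw [← hϖ, IsScalarTower.algebraMap_apply (𝓞 (maximalRealSubfield K)) (𝓞 K) K]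
  have hβ : 𝓇 ϖ₀ = (-1 - 2 * (ζ + ζ ^ 31) + (ζ + ζ ^ 31) ^ 2) := by rw [hϖ, hP]
  have hN := norm_primeThirtyOne hζ ϖ₀ hβ
  have hϖ0 : ϖ₀ ≠ 0 := by
    rintro rfl
    simp at hN
  obtain ⟨ζ', h1, h2, h3, h4⟩ := exists_type_span_sqrtNegOne_det hζ Φ hneg hposc ϖ₀ hϖ0
  refine ⟨Ideal.span {ϖ₀}, h𝔣₀, ζ', h1, h2, h3, fun x hx a ha => ?_⟩
  rw [h4 x hx a ha, hN]
  norm_num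

/-- **`[3968] = [31] ≠ splitDiscriminantClass 4 1` in `ℚˣ/Nm(ℚ(√−1)ˣ)`** (`31/3968 = (1 / 16)² + 1·(1 / 16)² ∈ Nm`; `31` is INERT in `ℚ(√−1)`:
`x² + 1·y²` anisotropic mod `31` by `decide`, `Ring2WeilNormDescent.natCast_not_mem_normUnitsSubgroup`; `n = 4` even): the type-`(π₃₁)` polarised Weil-type `ℤ[ζ₃₂]`-CM eightfolds for `ℚ(i)` lie on the NON-SPLIT row W8.1.31 `= (4, ℚ(i), 31)`.
research route conditional on HC_CM; not a corollary; Q11.4-sentence-2 already refuted in dim ≥ 3. [cite: vanGeemen1994HodgeAV, 5.4 and (5.4.1)] [cite: Serre1973, Ch. III §1] -/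
theorem mk0_det_primeThirtyOne_sqrtNegOne :
    (QuotientGroup.mk (Units.mk0 (3968 : ℚ) (by norm_num)) : weilNormResidueGroup 1) =
        QuotientGroup.mk (Units.mk0 (31 : ℚ) (by norm_num)) ∧
      (QuotientGroup.mk (Units.mk0 (31 : ℚ) (by norm_num)) : weilNormResidueGroup 1) ≠
        splitDiscriminantClass 4 1 := by
  constructor
  · rw [QuotientGroup.eq]
    have e : (Units.mk0 (3968 : ℚ) (by norm_num))⁻¹ * Units.mk0 (31 : ℚ) (by norm_num) =
        Units.mk0 ((31 / 3968) : ℚ) (by norm_num) := Units.ext (by norm_num)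
    rw [e]
    exact mem_normUnitsSubgroup_of_sq_add_mul_sq _ ((1 / 16) : ℚ) ((1 / 16) : ℚ) (by norm_num)
  · have hns : ∀ t : ZMod 31, t ^ 2 ≠ -((1 : ℕ) : ZMod 31) := by decide
    haveI : Fact (Nat.Prime 31) := ⟨by norm_num⟩
    have hA := descent_hyps_of_anisotropic (anisotropic_of_forall_sq_ne (p := 31) (d := 1) hns)
    exact mk_ne_splitDiscriminantClass_of_even _
      (natCast_not_mem_normUnitsSubgroup (p := 31) (d := 1) (a := 31) (by norm_num) (by norm_num) (by norm_num) hA.1 hA.2 _)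
      (by decide)

/-! ### §3 `K_d = ℚ(√−2)` (`s = s₂`): census form for the type `(π₃₁)`, class `[31]` NON-SPLIT (row W8.2.31) -/

open scoped Classical in
/-- **CENSUS FORM** (`K_d = ℚ(√−2)` at `32`): for every CM type `Φ` of `s₂`-signature `(4,4)` there is a type `𝔣₀ ⊆ 𝓞 K⁺` with
`𝔬𝔣₀ = (π₃₁)` (`𝔣₀ = (ϖ₀)`, `ϖ₀ ∈ 𝓞 K⁺` under `π₃₁`) such that `ℂ^Φ/Φ(ℤ[ζ_32])` CARRIES a `Φ`-positive divisor of type `(K; Φ; 𝔣₀)`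
(part 61: every type occurs at `32`) and EVERY such divisor has van Geemen Gram determinant `63488 = 31·2048` in the real frame `θ^i`
(the law of part 199 with `|N(ϖ₀)| = |−31|`): the type-`(π₃₁)` polarised Weil-type `ℤ[ζ₃₂]`-CM eightfolds for `ℚ(√−2)` lie on the NON-SPLIT row W8.2.31 `= (4, ℚ(√−2), 31)`.
research route conditional on HC_CM; not a corollary; Q11.4-sentence-2 already refuted in dim ≥ 3. [cite: vanGeemen1994HodgeAV, Lemma 5.2 (3)–(4) and (5.4.1)] [cite: Shimura1998, §14.3 Prop. 4–5, pp. 103–104] -/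
theorem exists_primeThirtyOne_sqrtNegTwo_det [IsCyclotomicExtension {32} ℚ K] [IsCMField K]
    (hζ : IsPrimitiveRoot ζ 32) (Φ : CMType K)
    (hneg : (Finset.univ.filter fun φ : Φ.1 => (φ.1 (ζ ^ 4 + ζ ^ 12)).im < 0).card = 4)
    (hposc : (Finset.univ.filter fun φ : Φ.1 => 0 < (φ.1 (ζ ^ 4 + ζ ^ 12)).im).card = 4) :
    ∃ 𝔣₀ : Ideal (𝓞 (maximalRealSubfield K)),
      𝔣₀.map (algebraMap (𝓞 (maximalRealSubfield K)) (𝓞 K)) =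
        Ideal.span {(-1 - 2 * (hζ.toInteger + hζ.toInteger ^ 31) + (hζ.toInteger + hζ.toInteger ^ 31) ^ 2)} ∧
      ∃ ζ' : K, IsCMField.complexConj K ζ' = -ζ' ∧ (∀ φ : Φ.1, 0 < (φ.1 ζ').im) ∧
        CMTypeLattice.IsOfType (1 : (FractionalIdeal (𝓞 K)⁰ K)ˣ) ζ' 𝔣₀ ∧
        ∀ (x : Fin 8 → K), (∀ i, x i = (ζ + ζ⁻¹) ^ (i : ℕ)) → ∀ a : Matrix (Fin 8) (Fin 8) ℚ,
          (∀ i j, a i j = Algebra.trace ℚ K (ζ' * x i * IsCMField.complexConj K ((ζ ^ 4 + ζ ^ 12) * x j))) →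
          a.det = 63488 := by
  have hP := coe_primeThirtyOne hζ
  have hreal : IsCMField.complexConj K ((((-1 - 2 * (hζ.toInteger + hζ.toInteger ^ 31) + (hζ.toInteger + hζ.toInteger ^ 31) ^ 2) : 𝓞 K)) : K) =
      ((((-1 - 2 * (hζ.toInteger + hζ.toInteger ^ 31) + (hζ.toInteger + hζ.toInteger ^ 31) ^ 2) : 𝓞 K)) : K) := by
    rw [hP]; exact complexConj_primeThirtyOne hζ
  obtain ⟨ϖ₀, hϖ⟩ := (IsCMField.RingOfIntegers.complexConj_eq_self_iff (K := K) _).mp hreal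
  have h𝔣₀ : (Ideal.span {ϖ₀}).map (algebraMap (𝓞 (maximalRealSubfield K)) (𝓞 K)) =
      Ideal.span {(-1 - 2 * (hζ.toInteger + hζ.toInteger ^ 31) + (hζ.toInteger + hζ.toInteger ^ 31) ^ 2)} := by
    rw [Ideal.map_span, Set.image_singleton]
    congr 2
    apply RingOfIntegers.ext
    rw [← hϖ, IsScalarTower.algebraMap_apply (𝓞 (maximalRealSubfield K)) (𝓞 K) K]
  have hβ : 𝓇 ϖ₀ = (-1 - 2 * (ζ + ζ ^ 31) + (ζ + ζ ^ 31) ^ 2) := by rw [hϖ, hP]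
  have hN := norm_primeThirtyOne hζ ϖ₀ hβ
  have hϖ0 : ϖ₀ ≠ 0 := by
    rintro rfl
    simp at hN
  obtain ⟨ζ', h1, h2, h3, h4⟩ := exists_type_span_sqrtNegTwo_det hζ Φ hneg hposc ϖ₀ hϖ0
  refine ⟨Ideal.span {ϖ₀}, h𝔣₀, ζ', h1, h2, h3, fun x hx a ha => ?_⟩
  rw [h4 x hx a ha, hN]
  norm_num

/-- **`[63488] = [31] ≠ splitDiscriminantClass 4 2` in `ℚˣ/Nm(ℚ(√−2)ˣ)`** (`31/63488 = 0² + 2·(1 / 64)² ∈ Nm`; `31` is INERT in `ℚ(√−2)`: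
`x² + 2·y²` anisotropic mod `31` by `decide`, `Ring2WeilNormDescent.natCast_not_mem_normUnitsSubgroup`; `n = 4` even): the type-`(π₃₁)` polarised Weil-type `ℤ[ζ₃₂]`-CM eightfolds for `ℚ(√−2)` lie on the NON-SPLIT row W8.2.31 `= (4, ℚ(√−2), 31)`.
research route conditional on HC_CM; not a corollary; Q11.4-sentence-2 already refuted in dim ≥ 3. [cite: vanGeemen1994HodgeAV, 5.4 and (5.4.1)] [cite: Serre1973, Ch. III §1] -/
theorem mk0_det_primeThirtyOne_sqrtNegTwo :
    (QuotientGroup.mk (Units.mk0 (63488 : ℚ) (by norm_num)) : weilNormResidueGroup 2) =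
        QuotientGroup.mk (Units.mk0 (31 : ℚ) (by norm_num)) ∧
      (QuotientGroup.mk (Units.mk0 (31 : ℚ) (by norm_num)) : weilNormResidueGroup 2) ≠
        splitDiscriminantClass 4 2 := by
  constructor
  · rw [QuotientGroup.eq]
    have e : (Units.mk0 (63488 : ℚ) (by norm_num))⁻¹ * Units.mk0 (31 : ℚ) (by norm_num) =
        Units.mk0 ((31 / 63488) : ℚ) (by norm_num) := Units.ext (by norm_num)
    rw [e]
    exact mem_normUnitsSubgroup_of_sq_add_mul_sq _ (0 : ℚ) ((1 / 64) : ℚ) (by norm_num)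
  · have hns : ∀ t : ZMod 31, t ^ 2 ≠ -((2 : ℕ) : ZMod 31) := by decide
    haveI : Fact (Nat.Prime 31) := ⟨by norm_num⟩
    have hA := descent_hyps_of_anisotropic (anisotropic_of_forall_sq_ne (p := 31) (d := 2) hns)
    exact mk_ne_splitDiscriminantClass_of_even _
      (natCast_not_mem_normUnitsSubgroup (p := 31) (d := 2) (a := 31) (by norm_num) (by norm_num) (by norm_num) hA.1 hA.2 _)
      (by decide)

end Summit.HodgeConjecture.Ring2WeilCoverage.WeilGramLevel32PrimeThirtyOneTypes

end
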